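import Summits.ABC.ABC.Theorems.IUTThetaPilotThetaPartIIULineCapstone
import HarnessLib

/-!
# Crux `ThetaPartII` (stmt-ABC-19678, route `IUTThetaPilot`), (U) line: the crux — and `ABC` — with BOTH (U)-stubs demanded
# ONLY at SZPIRO-BAD admissible points (the «hreg ↦ hregBad» tail of plan RULING C-R28 (3)(α))

Proof-only helper of the abc-iut cell (R2 S-chain seat abc-iut-s2-p2 gen 2, claim «HREG-ALPHA-TAIL»); TAKES NO SIDE on [IUTchIII]
Cor. 3.12 or on the (U)/(P) readings. Mochizuki, *Inter-universal Teichmüller theory IV* (RIMS manuscript Apr. 2020 = PRIMS **57**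
(2021)) Thm. 1.10 (pp. 22–31), Cor. 2.2 (ii) (pp. 41–48); [IUTchIII] Cor. 3.12 (kurims p. 174).

abc-iut-c312-8's capstone `ThetaPartII.ABC_of_cor312_of_hullRegime` (this directory, `…ULineCapstone`) derives `ABC` from the two OPEN
(U)-stubs `stub_cor312` (the disputed Corollary, reading (U)) and `stub_hullRegime` (the hull estimate with print's `B_III(P, l)` OFF the
slot-constant regime — the CONE binder `hreg` of the branch-C certificates of record, VERDICT RISK ¶7). What the route's tail CONSUMES per
admissible `(P, l)` is only the squeeze `((l+1)/24 − 1/(2l))·log q^{∤{2,l}}(λ) ≤ B_III(P,l) + ((l+5)/4)·log π`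
(`ThetaPartIIDisplay.ThetaPartII_of_squeezeIII`, abc-iut-S-d2). At a SZPIRO-GOOD point in the sense of abc-iut-c312-d1
(`Cor22.ThetaVolumeDatumAt.cor312Of_of_szpiro`, p449008: `d_mod ≤ (l+5)/4` and
`log q^{∤2l} ≤ (6l(l+5−4d_mod)/((l+4)(l−3)))·(log-diff + (1 − 1/l)·log-cond) + (6l(l+5)/((l+4)(l−3)))·log π`) that squeeze is
CONTENT-FREE: multiplying by `κ_l = (l+4)(l−3)/(24l)` gives `κ_l·log q ≤ ((l+5)/4 − d_mod)·(lD + (1−1/l)·lC) + ((l+5)/4)·log π`, and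
`(l+5)/4 − d_mod ≤ (l+1)/4 ≤ ((l+1)/4)·(1 + 12d_mod/l)` because `d_mod ≥ 1`, the remaining summands of `B_III` being `≥ 0`. Hence
NEITHER (U)-stub is needed at Szpiro-good points, and both may be restricted to the complementary SZPIRO-BAD locus
(`(l+5)/4 < d_mod ∨ bound < log q^{∤2l}`, the antecedent of abc-iut-c312-d1's `Cor22.forall_cor312Of_of_szpiroBad`, text copied):

* `squeeze_of_szpiroGood` — the content-free squeeze at a Szpiro-good `(P, l)`, `l ≥ 5` (no datum, no Corollary, no hull binder);
* `squeeze_of_cor312At_of_hullRegimeAt` — at ONE admissible `(P, l)`: `Cor22.Cor312AtDatum P l` and the hull regime AT `(P, l)` give the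
  squeeze (slot-constant data by abc-iut-S3's `PointDict.hullEstimateOf_BIII_pinned` over abc-iut-S1's `stub_R4`; a datum by abc-iut-L5-t7's
  `stub_thetaData`; the squeeze by abc-iut-S2's `PointDict.logQAvoid_le_of_cor312AtDatum`);
* **`ThetaPartII_of_cor312Bad_of_hullRegimeBad`** / **`ABC_of_cor312Bad_of_hullRegimeBad`** — the crux, and `ABC`, from the two
  (U)-stubs demanded ONLY at Szpiro-bad admissible `(P, l)`;
* `hullRegimeBad_of_hullRegime` / `cor312Bad_of_cor312` — the restricted binders are WEAKER than the registered ones (premise drop), so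
  abc-iut-c312-8's `ABC_of_cor312_of_hullRegime h312 hreg` is `ABC_of_cor312Bad_of_hullRegimeBad (cor312Bad_of_cor312 h312)
  (hullRegimeBad_of_hullRegime hreg)` (not restated here: same type as the landed capstone).

READING (for the planners; numbers, not a side). After the kernel refutation of the blanket binder `hreg` announced by abc-iut-s2-p5 g2 /
abc-iut-C-cert-1 g3 (an explicit admissible `d_mod = 2` family with a mixed prime), `hregBad` is RULING C-R28 (3)(α)'s residual CONE binder:
it is not instantiable at that family unless the family is shown Szpiro-bad at the refuting `(k, l)` (undecided in the tree: `log 𝔣(λ_k)`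
depends on the radical of `N((3+√2)^k ± 4)`), and its truth at Szpiro-bad mixed points is governed by the same sharp necessity
(abc-iut-s2-p1's `pointMixedShare_le_slack_of_hreg` applies verbatim under the extra guard) — a Szpiro-type statement, not claimed here.
HONEST FRAMING: route-level plumbing and real arithmetic; nothing asserted about [IUTchIII] Cor. 3.12, Thm. 1.10, any point or any author;
CONDITIONAL theorems; typed ≠ proved. [cite: Mochizuki2012, IUTchIV Thm. 1.10 p. 22–23, Step (viii) p. 30; Cor. 2.2 (ii) p. 46]
[cite: Mochizuki2012, IUTchIII Cor. 3.12 p. 174] [claim: Mochizuki2012, status: disputed] for every IUT quotation.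
-/

set_option linter.dupNamespace false

noncomputable section

namespace Summit.ABC.ABC.Theorems.ThetaPartII

open Literature.NumberTheory.DiophantineGeometry.GenEll Literature.IUT.LogVolume Literature.IUT.HodgeTheaters
open Summit.ABC.IUTFork NumberField IsDedekindDomain Literature.NumberTheory.NumberFields

variable {P : NFPoint} {l : ℕ}

/-- Real arithmetic of the Szpiro-good case: with `κ = (l+4)(l−3)/(24l) = (l+1)/24 − 1/(2l)`, `1 ≤ d ≤ (l+5)/4`, `l ≥ 5`,
`lD, lC, R ≥ 0` and `Q ≤ (6l(l+5−4d)/((l+4)(l−3)))·(lD + (1−1/l)·lC) + (6l(l+5)/((l+4)(l−3)))·π'`, one has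
`κ·Q ≤ ((l+1)/4)·((1+12d/l)(lD+lC) + R) + ((l+5)/4)·π'`. [folklore] -/
private theorem kappa_mul_le_of_szpiroGood {l d lD lC R Q π' : ℝ} (hl : 5 ≤ l) (hd1 : 1 ≤ d) (hd : d ≤ (l + 5) / 4)
    (hD : 0 ≤ lD) (hC : 0 ≤ lC) (hR : 0 ≤ R)
    (hQ : Q ≤ 6 * l * ((l + 5) - 4 * d) / ((l + 4) * (l - 3)) * (lD + (1 - 1 / l) * lC)
      + 6 * l * (l + 5) / ((l + 4) * (l - 3)) * π') :
    ((l + 1) / 24 - 1 / (2 * l)) * Q ≤ (l + 1) / 4 * ((1 + 12 * d / l) * (lD + lC) + R) + (l + 5) / 4 * π' := by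
  have hl0 : (0 : ℝ) < l := by linarith
  have hden : 0 < (l + 4) * (l - 3) := by nlinarith
  have h4 : l + 4 ≠ 0 := by linarith
  have h3 : l - 3 ≠ 0 := by linarith
  -- `κ = (l+4)(l−3)/(24 l)`
  have hκ : (l + 1) / 24 - 1 / (2 * l) = (l + 4) * (l - 3) / (24 * l) := by
    field_simp
    ring
  have hκ0 : 0 ≤ (l + 4) * (l - 3) / (24 * l) := by positivity
  -- multiply the Szpiro-good bound by `κ`
  have hmul := mul_le_mul_of_nonneg_left hQ hκ0
  have e1 : (l + 4) * (l - 3) / (24 * l) *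
      (6 * l * ((l + 5) - 4 * d) / ((l + 4) * (l - 3)) * (lD + (1 - 1 / l) * lC)
        + 6 * l * (l + 5) / ((l + 4) * (l - 3)) * π') =
      ((l + 5) / 4 - d) * (lD + (1 - 1 / l) * lC) + (l + 5) / 4 * π' := by
    field_simp
    ring
  rw [e1] at hmul
  rw [hκ]
  -- compare the two right-hand sides
  have hL : lD + (1 - 1 / l) * lC ≤ lD + lC := by
    have : 0 ≤ 1 / l * lC := by positivity
    nlinarith
  have hc0 : 0 ≤ (l + 5) / 4 - d := by linarith
  have hstep1 : ((l + 5) / 4 - d) * (lD + (1 - 1 / l) * lC) ≤ ((l + 5) / 4 - d) * (lD + lC) :=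
    mul_le_mul_of_nonneg_left hL hc0
  have hcoef : (l + 5) / 4 - d ≤ (l + 1) / 4 * (1 + 12 * d / l) := by
    have : 0 ≤ (l + 1) / 4 * (12 * d / l) := by positivity
    nlinarith
  have hDC : 0 ≤ lD + lC := add_nonneg hD hC
  have hstep2 : ((l + 5) / 4 - d) * (lD + lC) ≤ (l + 1) / 4 * (1 + 12 * d / l) * (lD + lC) :=
    mul_le_mul_of_nonneg_right hcoef hDC
  have hR' : 0 ≤ (l + 1) / 4 * R := by positivity
  nlinarith [hmul, hstep1, hstep2, hR']

/-- **THE CONTENT-FREE SQUEEZE AT A SZPIRO-GOOD POINT.** For `l ≥ 5` and a point `P` with `d_mod ≤ (l+5)/4` satisfying abc-iut-c312-d1's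
Szpiro-good inequality `log q^{∤{2,l}}(λ) ≤ (6l(l+5−4d_mod)/((l+4)(l−3)))·(log-diff(λ) + (1 − 1/l)·log 𝔣^{∤{2,l}}(λ)) + (6l(l+5)/((l+4)(l−3)))·log π`,
the squeeze consumed by the route's tail holds outright:
`((l+1)/24 − 1/(2l))·log q^{∤{2,l}}(λ) ≤ B_III(P, l) + ((l+5)/4)·log π` — no Θ-volume datum, no [IUTchIII] Cor. 3.12, no hull binder
(`d_mod ≥ 1`, `Cor22.dmod_pos`; `log-diff, log-cond, 2 log l + 52 + (20/3)·log(d*l)·π(d*l) ≥ 0`). The (U)-line twin of abc-iut-c312-d1's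
content-free regions. [cite: Mochizuki2012, IUTchIV Thm. 1.10 p. 22–23; Cor. 2.2 (ii) proof p. 46] [claim: Mochizuki2012, status: disputed] -/
theorem squeeze_of_szpiroGood (h5 : 5 ≤ l) (hd : (Cor22.dmod P : ℝ) ≤ ((l : ℝ) + 5) / 4)
    (hq : Cor22.logQAvoid P {2, l} ≤
      6 * l * (((l : ℝ) + 5) - 4 * Cor22.dmod P) / (((l : ℝ) + 4) * ((l : ℝ) - 3))
          * (P.logDiff + (1 - 1 / (l : ℝ)) * Cor22.logCondAvoid P {2, l})
        + 6 * l * ((l : ℝ) + 5) / (((l : ℝ) + 4) * ((l : ℝ) - 3)) * Real.log Real.pi) :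
    (((l : ℝ) + 1) / 24 - 1 / (2 * l)) * Cor22.logQAvoid P {2, l} ≤
      ((l : ℝ) + 1) / 4 *
          ((1 + 12 * (Cor22.dmod P : ℝ) / l) * (P.logDiff + Cor22.logCondAvoid P {2, l})
            + 2 * Real.log l + 52
            + 20 / 3 * Real.log (((2 ^ 12 * 3 ^ 3 * 5 * Cor22.dmod P : ℕ) : ℝ) * (l : ℝ))
              * (Nat.primeCounting (2 ^ 12 * 3 ^ 3 * 5 * Cor22.dmod P * l) : ℝ))
        + ThetaVolumeInput.archLogTheta l := by
  have hl5 : (5 : ℝ) ≤ (l : ℝ) := by exact_mod_cast h5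
  have hd1 : (1 : ℝ) ≤ (Cor22.dmod P : ℝ) := by exact_mod_cast Cor22.dmod_pos P
  have hD : 0 ≤ P.logDiff := P.logDiff_nonneg
  have hC : 0 ≤ Cor22.logCondAvoid P {2, l} := Cor22.logCondAvoid_nonneg P _
  have harch : ThetaVolumeInput.archLogTheta l = ((l : ℝ) + 5) / 4 * Real.log Real.pi := rfl
  -- the rounding / prime terms of `B_III` are nonnegative
  have hlog : 0 ≤ Real.log (l : ℝ) := Real.log_nonneg (by linarith)
  have hdl1 : (1 : ℝ) ≤ ((2 ^ 12 * 3 ^ 3 * 5 * Cor22.dmod P : ℕ) : ℝ) * (l : ℝ) := by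
    have h1 : (1 : ℝ) ≤ ((2 ^ 12 * 3 ^ 3 * 5 * Cor22.dmod P : ℕ) : ℝ) := by
      have := Cor22.dmod_pos P
      exact_mod_cast (by nlinarith : 1 ≤ 2 ^ 12 * 3 ^ 3 * 5 * Cor22.dmod P)
    nlinarith
  have hlog' : 0 ≤ Real.log (((2 ^ 12 * 3 ^ 3 * 5 * Cor22.dmod P : ℕ) : ℝ) * (l : ℝ)) := Real.log_nonneg hdl1
  have hπc : 0 ≤ (Nat.primeCounting (2 ^ 12 * 3 ^ 3 * 5 * Cor22.dmod P * l) : ℝ) := Nat.cast_nonneg _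
  have hR : 0 ≤ 2 * Real.log l + 52
      + 20 / 3 * Real.log (((2 ^ 12 * 3 ^ 3 * 5 * Cor22.dmod P : ℕ) : ℝ) * (l : ℝ))
        * (Nat.primeCounting (2 ^ 12 * 3 ^ 3 * 5 * Cor22.dmod P * l) : ℝ) := by positivity
  have key := kappa_mul_le_of_szpiroGood (Q := Cor22.logQAvoid P {2, l}) hl5 hd1 hd hD hC hR hq
  rw [harch]
  have e : ((l : ℝ) + 1) / 4 *
      ((1 + 12 * (Cor22.dmod P : ℝ) / l) * (P.logDiff + Cor22.logCondAvoid P {2, l})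
        + 2 * Real.log l + 52
        + 20 / 3 * Real.log (((2 ^ 12 * 3 ^ 3 * 5 * Cor22.dmod P : ℕ) : ℝ) * (l : ℝ))
          * (Nat.primeCounting (2 ^ 12 * 3 ^ 3 * 5 * Cor22.dmod P * l) : ℝ)) =
      ((l : ℝ) + 1) / 4 *
      ((1 + 12 * (Cor22.dmod P : ℝ) / l) * (P.logDiff + Cor22.logCondAvoid P {2, l})
        + (2 * Real.log l + 52
        + 20 / 3 * Real.log (((2 ^ 12 * 3 ^ 3 * 5 * Cor22.dmod P : ℕ) : ℝ) * (l : ℝ))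
          * (Nat.primeCounting (2 ^ 12 * 3 ^ 3 * 5 * Cor22.dmod P * l) : ℝ))) := by ring
  rw [e]
  exact key

/-- **THE SQUEEZE AT ONE ADMISSIBLE POINT from the two (U)-stubs AT THAT POINT.** For `λ ∈ U_P`, a prime `l ≥ 5` with «admits a core»,
(P2), (P5), (P6): [IUTchIII] Cor. 3.12 in reading (U) at the Θ-volume data of `(P, l)` (`Cor22.Cor312AtDatum P l`) and the hull estimate with
`B_III(P, l)` at the NON-slot-constant data of `(P, l)` give `((l+1)/24 − 1/(2l))·log q^{∤{2,l}}(λ) ≤ B_III(P,l) + ((l+5)/4)·log π` — slot-constant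
data by abc-iut-S3's `PointDict.hullEstimateOf_BIII_pinned` over abc-iut-S1's `stub_R4` ([IUTchIV] Thm. 1.10 Steps (ii)–(v) p. 24–29), a datum
by abc-iut-L5-t7's `stub_thetaData`, the squeeze by abc-iut-S2's `PointDict.logQAvoid_le_of_cor312AtDatum`. CONDITIONAL; nothing asserted.
[cite: Mochizuki2012, IUTchIV Cor. 2.2 (ii) p. 46] [cite: Mochizuki2012, IUTchIII Cor. 3.12 p. 174] [claim: Mochizuki2012, status: disputed] -/
theorem squeeze_of_cor312At_of_hullRegimeAt (hP : P ∈ UP) (hl : l.Prime) (h5 : 5 ≤ l) (hcore : Cor22.AdmitsCore P)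
    (h2 : Cor22.CondP2 P l) (hP5 : Cor22.CondP5 P l) (h6 : Cor22.CondP6 P l)
    (h312P : Cor22.Cor312AtDatum P l)
    (hregP : ∀ T : Cor22.ThetaVolumeDatumAt P l,
        (letI := T.instFieldF; letI := T.instNumberFieldF; letI := T.instAlgebraF; letI := T.instFieldK
         letI := T.instNumberFieldK; letI := T.instAlgebraK; letI := T.instFieldFbar; letI := T.instAlgebraFbar
         letI := T.instAlgebraKFbar; letI := T.instIsElliptic
         ¬ (∀ p ∈ T.I.supportPrimes, ∀ v w : placesOver (fieldOfModuli T.E) p,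
            (Summit.ABC.IUTFork.DHData.ofInput T.I).logQloc p v = (Summit.ABC.IUTFork.DHData.ofInput T.I).logQloc p w)) →
        T.HullEstimateOf
          (((l : ℝ) + 1) / 4 *
            ((1 + 12 * (Cor22.dmod P : ℝ) / l) * (P.logDiff + Cor22.logCondAvoid P {2, l})
              + 2 * Real.log l + 52
              + 20 / 3 * Real.log (((2 ^ 12 * 3 ^ 3 * 5 * Cor22.dmod P : ℕ) : ℝ) * (l : ℝ))
                * (Nat.primeCounting (2 ^ 12 * 3 ^ 3 * 5 * Cor22.dmod P * l) : ℝ)))) :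
    (((l : ℝ) + 1) / 24 - 1 / (2 * l)) * Cor22.logQAvoid P {2, l} ≤
      ((l : ℝ) + 1) / 4 *
          ((1 + 12 * (Cor22.dmod P : ℝ) / l) * (P.logDiff + Cor22.logCondAvoid P {2, l})
            + 2 * Real.log l + 52
            + 20 / 3 * Real.log (((2 ^ 12 * 3 ^ 3 * 5 * Cor22.dmod P : ℕ) : ℝ) * (l : ℝ))
              * (Nat.primeCounting (2 ^ 12 * 3 ^ 3 * 5 * Cor22.dmod P * l) : ℝ))
        + ThetaVolumeInput.archLogTheta l := by
  obtain ⟨T₀⟩ := stub_thetaData P hP l hl h5 hcore h2 hP5 h6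
  have h7 : 7 ≤ l := seven_le_of_condP6 hP hl h5 h6
  have hvolP : Cor22.HullVolumeAtDatum P l
      (((l : ℝ) + 1) / 4 *
        ((1 + 12 * (Cor22.dmod P : ℝ) / l) * (P.logDiff + Cor22.logCondAvoid P {2, l})
          + 2 * Real.log l + 52
          + 20 / 3 * Real.log (((2 ^ 12 * 3 ^ 3 * 5 * Cor22.dmod P : ℕ) : ℝ) * (l : ℝ))
            * (Nat.primeCounting (2 ^ 12 * 3 ^ 3 * 5 * Cor22.dmod P * l) : ℝ))) := by
    intro T
    letI := T.instFieldF; letI := T.instNumberFieldF; letI := T.instAlgebraF; letI := T.instFieldK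
    letI := T.instNumberFieldK; letI := T.instAlgebraK; letI := T.instFieldFbar; letI := T.instAlgebraFbar
    letI := T.instAlgebraKFbar; letI := T.instIsElliptic
    by_cases hc : ∀ p ∈ T.I.supportPrimes, ∀ v w : placesOver (fieldOfModuli T.E) p,
        (Summit.ABC.IUTFork.DHData.ofInput T.I).logQloc p v = (Summit.ABC.IUTFork.DHData.ofInput T.I).logQloc p w
    · exact Summit.ABC.IUTFork.PointDict.hullEstimateOf_BIII_pinned T hP h7 (stub_R4 P hP l hl h5 hcore h2 hP5 h6 T) hc
    · exact hregP T hc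
  exact Summit.ABC.IUTFork.PointDict.logQAvoid_le_of_cor312AtDatum h312P hvolP T₀ hP.1

/-- **The crux `ThetaPartII` with BOTH (U)-stubs demanded ONLY at SZPIRO-BAD admissible points** (RULING C-R28 (3)(α) tail). Hypotheses,
each only at `λ ∈ U_P`, `l` prime `≥ 5`, «admits a core», (P2), (P5), (P6) AND the Szpiro-bad antecedent of abc-iut-c312-d1's
`Cor22.forall_cor312Of_of_szpiroBad` (`(l+5)/4 < d_mod ∨ (6l(l+5−4d_mod)/((l+4)(l−3)))·(log-diff + (1 − 1/l)·log-cond) + (6l(l+5)/((l+4)(l−3)))·log π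
< log q^{∤{2,l}}(λ)`): `h312Bad` — [IUTchIII] Cor. 3.12 (reading (U)) at the Θ-volume data; `hregBad` — the hull estimate with `B_III(P,l)` at the
non-slot-constant data. At Szpiro-good points the squeeze is `squeeze_of_szpiroGood` (content-free); at Szpiro-bad points it is
`squeeze_of_cor312At_of_hullRegimeAt`; then abc-iut-S-d2's `ThetaPartIIDisplay.ThetaPartII_of_squeezeIII`. CONDITIONAL; does not close the item;
nothing asserted about either hypothesis. [cite: Mochizuki2012, IUTchIV Cor. 2.2 (ii) pp. 41–48] [claim: Mochizuki2012, status: disputed] -/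
theorem ThetaPartII_of_cor312Bad_of_hullRegimeBad
    (h312Bad : ∀ P : NFPoint, P ∈ UP → ∀ l : ℕ, l.Prime → 5 ≤ l →
      Cor22.AdmitsCore P → Cor22.CondP2 P l → Cor22.CondP5 P l → Cor22.CondP6 P l →
      (((l : ℝ) + 5) / 4 < (Cor22.dmod P : ℝ) ∨
        6 * l * (((l : ℝ) + 5) - 4 * Cor22.dmod P) / (((l : ℝ) + 4) * ((l : ℝ) - 3))
            * (P.logDiff + (1 - 1 / (l : ℝ)) * Cor22.logCondAvoid P {2, l})
          + 6 * l * ((l : ℝ) + 5) / (((l : ℝ) + 4) * ((l : ℝ) - 3)) * Real.log Real.pi < Cor22.logQAvoid P {2, l}) →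
        Cor22.Cor312AtDatum P l)
    (hregBad : ∀ P : NFPoint, P ∈ UP → ∀ l : ℕ, l.Prime → 5 ≤ l →
      Cor22.AdmitsCore P → Cor22.CondP2 P l → Cor22.CondP5 P l → Cor22.CondP6 P l →
      (((l : ℝ) + 5) / 4 < (Cor22.dmod P : ℝ) ∨
        6 * l * (((l : ℝ) + 5) - 4 * Cor22.dmod P) / (((l : ℝ) + 4) * ((l : ℝ) - 3))
            * (P.logDiff + (1 - 1 / (l : ℝ)) * Cor22.logCondAvoid P {2, l})
          + 6 * l * ((l : ℝ) + 5) / (((l : ℝ) + 4) * ((l : ℝ) - 3)) * Real.log Real.pi < Cor22.logQAvoid P {2, l}) →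
      ∀ T : Cor22.ThetaVolumeDatumAt P l,
        (letI := T.instFieldF; letI := T.instNumberFieldF; letI := T.instAlgebraF; letI := T.instFieldK
         letI := T.instNumberFieldK; letI := T.instAlgebraK; letI := T.instFieldFbar; letI := T.instAlgebraFbar
         letI := T.instAlgebraKFbar; letI := T.instIsElliptic
         ¬ (∀ p ∈ T.I.supportPrimes, ∀ v w : placesOver (fieldOfModuli T.E) p,
            (Summit.ABC.IUTFork.DHData.ofInput T.I).logQloc p v = (Summit.ABC.IUTFork.DHData.ofInput T.I).logQloc p w)) →
        T.HullEstimateOf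
          (((l : ℝ) + 1) / 4 *
            ((1 + 12 * (Cor22.dmod P : ℝ) / l) * (P.logDiff + Cor22.logCondAvoid P {2, l})
              + 2 * Real.log l + 52
              + 20 / 3 * Real.log (((2 ^ 12 * 3 ^ 3 * 5 * Cor22.dmod P : ℕ) : ℝ) * (l : ℝ))
                * (Nat.primeCounting (2 ^ 12 * 3 ^ 3 * 5 * Cor22.dmod P * l) : ℝ)))) :
    Summit.ABC.ABC.Theses.IUTThetaPilot.ThetaPartII :=
  ThetaPartIIDisplay.ThetaPartII_of_squeezeIII fun P hP l hl h5 hcore hP2 hP5 h6 => by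
    by_cases hd : (Cor22.dmod P : ℝ) ≤ ((l : ℝ) + 5) / 4
    · by_cases hq : Cor22.logQAvoid P {2, l} ≤
          6 * l * (((l : ℝ) + 5) - 4 * Cor22.dmod P) / (((l : ℝ) + 4) * ((l : ℝ) - 3))
              * (P.logDiff + (1 - 1 / (l : ℝ)) * Cor22.logCondAvoid P {2, l})
            + 6 * l * ((l : ℝ) + 5) / (((l : ℝ) + 4) * ((l : ℝ) - 3)) * Real.log Real.pi
      · exact squeeze_of_szpiroGood h5 hd hq
      · exact squeeze_of_cor312At_of_hullRegimeAt hP hl h5 hcore hP2 hP5 h6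
          (h312Bad P hP l hl h5 hcore hP2 hP5 h6 (Or.inr (lt_of_not_ge hq)))
          (hregBad P hP l hl h5 hcore hP2 hP5 h6 (Or.inr (lt_of_not_ge hq)))
    · exact squeeze_of_cor312At_of_hullRegimeAt hP hl h5 hcore hP2 hP5 h6
        (h312Bad P hP l hl h5 hcore hP2 hP5 h6 (Or.inl (lt_of_not_ge hd)))
        (hregBad P hP l hl h5 hcore hP2 hP5 h6 (Or.inl (lt_of_not_ge hd)))

/-- **`ABC` with BOTH (U)-stubs demanded ONLY at SZPIRO-BAD admissible points** — through the route's deciding theorem `closes`, abc-iut-S6's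
`genEllTwo_holds` and the proved `JInvWlog_proof`. CONDITIONAL; nothing asserted about the two hypotheses; no side taken on [IUTchIII] Cor. 3.12
or on the (U)/(P) reading. [cite: Mochizuki2012, IUTchIV Cor. 2.2–2.3 pp. 41–55] [cite: Mochizuki2012, IUTchIII Cor. 3.12 p. 174]
[claim: Mochizuki2012, status: disputed] -/
theorem ABC_of_cor312Bad_of_hullRegimeBad
    (h312Bad : ∀ P : NFPoint, P ∈ UP → ∀ l : ℕ, l.Prime → 5 ≤ l →
      Cor22.AdmitsCore P → Cor22.CondP2 P l → Cor22.CondP5 P l → Cor22.CondP6 P l →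
      (((l : ℝ) + 5) / 4 < (Cor22.dmod P : ℝ) ∨
        6 * l * (((l : ℝ) + 5) - 4 * Cor22.dmod P) / (((l : ℝ) + 4) * ((l : ℝ) - 3))
            * (P.logDiff + (1 - 1 / (l : ℝ)) * Cor22.logCondAvoid P {2, l})
          + 6 * l * ((l : ℝ) + 5) / (((l : ℝ) + 4) * ((l : ℝ) - 3)) * Real.log Real.pi < Cor22.logQAvoid P {2, l}) →
        Cor22.Cor312AtDatum P l)
    (hregBad : ∀ P : NFPoint, P ∈ UP → ∀ l : ℕ, l.Prime → 5 ≤ l →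
      Cor22.AdmitsCore P → Cor22.CondP2 P l → Cor22.CondP5 P l → Cor22.CondP6 P l →
      (((l : ℝ) + 5) / 4 < (Cor22.dmod P : ℝ) ∨
        6 * l * (((l : ℝ) + 5) - 4 * Cor22.dmod P) / (((l : ℝ) + 4) * ((l : ℝ) - 3))
            * (P.logDiff + (1 - 1 / (l : ℝ)) * Cor22.logCondAvoid P {2, l})
          + 6 * l * ((l : ℝ) + 5) / (((l : ℝ) + 4) * ((l : ℝ) - 3)) * Real.log Real.pi < Cor22.logQAvoid P {2, l}) →
      ∀ T : Cor22.ThetaVolumeDatumAt P l,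
        (letI := T.instFieldF; letI := T.instNumberFieldF; letI := T.instAlgebraF; letI := T.instFieldK
         letI := T.instNumberFieldK; letI := T.instAlgebraK; letI := T.instFieldFbar; letI := T.instAlgebraFbar
         letI := T.instAlgebraKFbar; letI := T.instIsElliptic
         ¬ (∀ p ∈ T.I.supportPrimes, ∀ v w : placesOver (fieldOfModuli T.E) p,
            (Summit.ABC.IUTFork.DHData.ofInput T.I).logQloc p v = (Summit.ABC.IUTFork.DHData.ofInput T.I).logQloc p w)) →
        T.HullEstimateOf
          (((l : ℝ) + 1) / 4 *
            ((1 + 12 * (Cor22.dmod P : ℝ) / l) * (P.logDiff + Cor22.logCondAvoid P {2, l})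
              + 2 * Real.log l + 52
              + 20 / 3 * Real.log (((2 ^ 12 * 3 ^ 3 * 5 * Cor22.dmod P : ℕ) : ℝ) * (l : ℝ))
                * (Nat.primeCounting (2 ^ 12 * 3 ^ 3 * 5 * Cor22.dmod P * l) : ℝ)))) :
    _root_.ABC :=
  Summit.ABC.ABC.Theses.IUTThetaPilot.closes (ThetaPartII_of_cor312Bad_of_hullRegimeBad h312Bad hregBad)
    Summit.ABC.ABC.Theorems.genEllTwo_holds Summit.ABC.ABC.Theorems.JInvWlog_proof

/-- **The restricted hull binder is WEAKER than the registered one** (`stub_hullRegime` / the certificates' `hreg` ⟹ `hregBad`, premise drop).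
Nothing asserted about either. [cite: Mochizuki2012, IUTchIV Thm. 1.10 proof Step (v) p. 27–28] [claim: Mochizuki2012, status: disputed] -/
theorem hullRegimeBad_of_hullRegime
    (hreg : ∀ P : NFPoint, P ∈ UP → ∀ l : ℕ, l.Prime → 5 ≤ l →
      Cor22.AdmitsCore P → Cor22.CondP2 P l → Cor22.CondP5 P l → Cor22.CondP6 P l →
      ∀ T : Cor22.ThetaVolumeDatumAt P l,
        (letI := T.instFieldF; letI := T.instNumberFieldF; letI := T.instAlgebraF; letI := T.instFieldK
         letI := T.instNumberFieldK; letI := T.instAlgebraK; letI := T.instFieldFbar; letI := T.instAlgebraFbar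
         letI := T.instAlgebraKFbar; letI := T.instIsElliptic
         ¬ (∀ p ∈ T.I.supportPrimes, ∀ v w : placesOver (fieldOfModuli T.E) p,
            (Summit.ABC.IUTFork.DHData.ofInput T.I).logQloc p v = (Summit.ABC.IUTFork.DHData.ofInput T.I).logQloc p w)) →
        T.HullEstimateOf
          (((l : ℝ) + 1) / 4 *
            ((1 + 12 * (Cor22.dmod P : ℝ) / l) * (P.logDiff + Cor22.logCondAvoid P {2, l})
              + 2 * Real.log l + 52
              + 20 / 3 * Real.log (((2 ^ 12 * 3 ^ 3 * 5 * Cor22.dmod P : ℕ) : ℝ) * (l : ℝ))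
                * (Nat.primeCounting (2 ^ 12 * 3 ^ 3 * 5 * Cor22.dmod P * l) : ℝ)))) :
    ∀ P : NFPoint, P ∈ UP → ∀ l : ℕ, l.Prime → 5 ≤ l →
      Cor22.AdmitsCore P → Cor22.CondP2 P l → Cor22.CondP5 P l → Cor22.CondP6 P l →
      (((l : ℝ) + 5) / 4 < (Cor22.dmod P : ℝ) ∨
        6 * l * (((l : ℝ) + 5) - 4 * Cor22.dmod P) / (((l : ℝ) + 4) * ((l : ℝ) - 3))
            * (P.logDiff + (1 - 1 / (l : ℝ)) * Cor22.logCondAvoid P {2, l})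
          + 6 * l * ((l : ℝ) + 5) / (((l : ℝ) + 4) * ((l : ℝ) - 3)) * Real.log Real.pi < Cor22.logQAvoid P {2, l}) →
      ∀ T : Cor22.ThetaVolumeDatumAt P l,
        (letI := T.instFieldF; letI := T.instNumberFieldF; letI := T.instAlgebraF; letI := T.instFieldK
         letI := T.instNumberFieldK; letI := T.instAlgebraK; letI := T.instFieldFbar; letI := T.instAlgebraFbar
         letI := T.instAlgebraKFbar; letI := T.instIsElliptic
         ¬ (∀ p ∈ T.I.supportPrimes, ∀ v w : placesOver (fieldOfModuli T.E) p,
            (Summit.ABC.IUTFork.DHData.ofInput T.I).logQloc p v = (Summit.ABC.IUTFork.DHData.ofInput T.I).logQloc p w)) →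
        T.HullEstimateOf
          (((l : ℝ) + 1) / 4 *
            ((1 + 12 * (Cor22.dmod P : ℝ) / l) * (P.logDiff + Cor22.logCondAvoid P {2, l})
              + 2 * Real.log l + 52
              + 20 / 3 * Real.log (((2 ^ 12 * 3 ^ 3 * 5 * Cor22.dmod P : ℕ) : ℝ) * (l : ℝ))
                * (Nat.primeCounting (2 ^ 12 * 3 ^ 3 * 5 * Cor22.dmod P * l) : ℝ))) :=
  fun P hP l hl h5 hcore h2 hP5 h6 _ => hreg P hP l hl h5 hcore h2 hP5 h6

/-- **The restricted Corollary binder is WEAKER than the registered one** (`stub_cor312` ⟹ `h312Bad`, premise drop). Nothing asserted.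
[cite: Mochizuki2012, IUTchIII Cor. 3.12 p. 174] [claim: Mochizuki2012, status: disputed] -/
theorem cor312Bad_of_cor312
    (h312 : ∀ P : NFPoint, P ∈ UP → ∀ l : ℕ, l.Prime → 5 ≤ l →
      Cor22.AdmitsCore P → Cor22.CondP2 P l → Cor22.CondP5 P l → Cor22.CondP6 P l → Cor22.Cor312AtDatum P l) :
    ∀ P : NFPoint, P ∈ UP → ∀ l : ℕ, l.Prime → 5 ≤ l →
      Cor22.AdmitsCore P → Cor22.CondP2 P l → Cor22.CondP5 P l → Cor22.CondP6 P l →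
      (((l : ℝ) + 5) / 4 < (Cor22.dmod P : ℝ) ∨
        6 * l * (((l : ℝ) + 5) - 4 * Cor22.dmod P) / (((l : ℝ) + 4) * ((l : ℝ) - 3))
            * (P.logDiff + (1 - 1 / (l : ℝ)) * Cor22.logCondAvoid P {2, l})
          + 6 * l * ((l : ℝ) + 5) / (((l : ℝ) + 4) * ((l : ℝ) - 3)) * Real.log Real.pi < Cor22.logQAvoid P {2, l}) →
        Cor22.Cor312AtDatum P l :=
  fun P hP l hl h5 hcore h2 hP5 h6 _ => h312 P hP l hl h5 hcore h2 hP5 h6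

end Summit.ABC.ABC.Theorems.ThetaPartII

end
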